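import Summits.ABC.IUTFork.Conditional.AbcOfSGenuineMHullCellsTriple
import HarnessLib

/-!
# Branch C / R-W, M LINE: the hull licence FAILS at the own-ideles M-level setting of an abc-triple datum when R-H row 4's column fails at a
# PINNED local type transported from the K fibre — the K→M pinned-type socket (row «W:REF-EXACT-M-TWIN», pinned part)

PROOF-ONLY file (D-0012; 0 definitions, 0 `Prop` facts, no instance) of the abc-iut cell — D-0079 RESCUE sub-cell R-W «WINDOW Θ-SIDE INEQUALITY», seat
abc-iut-W-neg-1 (gen 6). TAKES NO SIDE on [IUTchIII] Cor. 3.12 (S. Mochizuki, *Inter-universal Teichmüller theory III*, Cor. 3.12 p. 173–174; Step (xi-f)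
p. 184) or on any author; «refuted as typed» ≠ «refuted in print». This seat's M hull-cell engine (`Cor312LicenceTripleHullCellRefuteM`, p527646) has the
PINNED member socket `WRowM.not_licence_triple_of_not_hullCell` (ONE member `x₀ ∈ V̲_u` of pinned tame type `e₀`) and the CLASS-ROBUST socket
(`…_of_hullCells_tameSharp`, `p ∉ {2, 3, 5, l}`); the K-line REFUTED theorems that pin an EXACT local type at a pole `p ∈ {3, 5}` with `p ∤ e₀` — e.g. abc-iut-C-cert-1's
`WRow.not_licence_frey160412424963707_three_band` over abc-iut-W-neg-2's `GenuineK.absRamificationIdx_kOf_frey160412424963707_three` (`e = 10·l` at `3`,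
`Cor312GenuineKWildExactTriple`) — have NO M twin, because the exact type is a statement about the K FIBRE `(thetaIndex (pilotDataOfK T.D T.K)).Fibre (inr p)`.
THIS FILE transports any pinned K-fibre type to the M members and closes the gap: §1 `WRowM.absRamificationIdx_kOfM_of_kFibre` — a member `x₀ ∈ V̲_u` sits on the
place `placeOfM x₀` of `K` over `p`, which IS the place of a K-fibre point `x'` (`fibreEquivPlacesOver`), and BOTH local fields are `RescaledCompletion T.K p ·` at that
place, so `e(K_{x₀}/ℚ_p) = e(K_{x'}/ℚ_p)` (`absRamificationIdx_rescaledCompletion`, as in p527646 §2); §2 **`WRowM.not_licence_triple_of_not_hullCell_kFibre`** — the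
pinned socket with the member hypothesis replaced by the K-fibre statement `∀ x', e(K_{x'}/ℚ_p) = e₀` (the fibre `V̲_u` is non-empty, `fibre_nonempty`), every idele
datum `r`; §3 **`GenuineM.not_pilotKummerCompatHull_triple_of_not_hullCell_kFibre`** — the same in the M books' instance shape (own ideles `ideleDataOf T.D T.isVolumeInputOf`,
analytic `logv`, pinned reading, every free binder), by abc-iut-c312-5's `licence_of_pilotKummerCompatHull` exactly as `AbcOfSGenuineMHullCellsTriple` (p528325).
HYPOTHESES `hpe`, `hP`, `hi`, `hlo`, `hhi`, `hneg` VERBATIM those of p527646 §1; `p ≠ 2`, `p ≠ l`, `p ∣ abc`, `p` prime (so `p ∈ {3, 5}` IS allowed when `p ∤ e₀`).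
HONEST SCOPE: OUR sharp containers and Dupuy–Hilado's typed (Ind1)/(Ind2); STRONGER-THAN-PRINT set-level reading of Step (xi-f); nothing about the printed GLOBAL
inequality, the number-level `Cor22.Cor312AtDatum` or any author's intended hull; typed ≠ proved; instantiated ≠ endorsed; no abc claim.
[cite: Mochizuki2012, IUTchI Def. 3.1 (e) p. 62, Ex. 3.2 (iv) p. 71; IUTchIII Cor. 3.12 Step (xi-f) p. 184; IUTchIV Prop. 1.1 p. 9, Prop. 1.2 (i)(ii) p. 10, Thm. 1.10 p. 22,
Cor. 2.2 (ii) proof (P5) p. 46] [cite: DupuyHilado2025, §3.4, §4.9, §4.12] [cite: Serre1972, §1.11–§1.12] [cite: NeukirchANT1999, Ch. II (5.5)] [claim: Mochizuki2012, status: disputed]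
for every IUT sentence.
-/

noncomputable section

open Set Function Metric NumberField IsDedekindDomain

namespace Summit.ABC.IUTFork.Conditional

open Thm311 Thm311.Real Cor312 Cor312Vol Cor312Prov Literature.IUT.LogThetaLattice Literature.IUT.LogVolume
  Literature.IUT.HodgeTheaters Literature.IUT.LogVolume.ThetaData Literature.IUT.LogVolume.Cor22
open Literature.NumberTheory.NumberFields Literature.NumberTheory.GaloisRepresentations.Ultrametric
open Literature.NumberTheory.DiophantineGeometry Literature.NumberTheory.DiophantineGeometry.GenEll Summit.ABC.ABC.Theorems
open Summit.ABC.IUTFork.Repair.RH.HullThresholdExact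

/-! ## §1. A pinned K-fibre local type IS the local type of every M member over the same prime -/

/-- **K-fibre → M-member transport of a pinned ramification index.** `T` a genuine Θ-volume datum, `u` a finite place of `ℚ` with `p_u = p`; if EVERY point
`x'` of the K fibre over `p` (`(thetaIndex (pilotDataOfK T.D T.K)).Fibre (inr p)`) has `e(K_{x'}/ℚ_p) = e₀`, then EVERY member `x₀ ∈ V̲_u` has `e(K_{x₀}/ℚ_p) = e₀`:
`placeOfM x₀` is a place of `K` over `p`, hence `placeOf x'` for the K-fibre point `x' := (fibreEquivPlacesOver _ p).symm ⟨placeOfM x₀, _⟩`, and both indices are the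
ramification index of that place (`absRamificationIdx_rescaledCompletion`). [cite: Serre1972, §1.11–§1.12] [cite: NeukirchANT1999, Ch. II (5.5)] -/
theorem WRowM.absRamificationIdx_kOfM_of_kFibre {P₀ : NFPoint} {l : ℕ} (T : Cor22.ThetaVolumeDatumAt P₀ l)
    (u : FinitePlace ℚ) (p : ℕ) (hu : ratChar u = p) (hp : p.Prime) {e₀ : ℕ}
    (hK : letI := T.instFieldF; letI := T.instNumberFieldF; letI := T.instAlgebraF; letI := T.instFieldK
      letI := T.instNumberFieldK; letI := T.instAlgebraK; letI := T.instFieldFbar; letI := T.instAlgebraFbar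
      letI := T.instAlgebraKFbar; letI := T.instIsElliptic
      haveI : Fact p.Prime := ⟨hp⟩
      ∀ x' : (thetaIndex (pilotDataOfK T.D T.K)).Fibre (.inr ⟨p, hp⟩), absRamificationIdx p (kOf (pilotDataOfK T.D T.K) p x') = e₀) :
    letI := T.instFieldF; letI := T.instNumberFieldF; letI := T.instAlgebraF; letI := T.instFieldK
    letI := T.instNumberFieldK; letI := T.instAlgebraK; letI := T.instFieldFbar; letI := T.instAlgebraFbar
    letI := T.instAlgebraKFbar; letI := T.instIsElliptic
    ∀ x₀ : (thetaIndexOfInitial T.D).Fibre (Val.non u),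
      absRamificationIdx (ratChar u) (kOfM T.D (ratChar u) u (natCast_ratChar_mem u) x₀) = e₀ := by
  classical
  letI := T.instFieldF; letI := T.instNumberFieldF; letI := T.instAlgebraF; letI := T.instFieldK
  letI := T.instNumberFieldK; letI := T.instAlgebraK; letI := T.instFieldFbar; letI := T.instAlgebraFbar
  letI := T.instAlgebraKFbar; letI := T.instIsElliptic
  intro x₀
  subst hu
  haveI hpfact : Fact (ratChar u).Prime := ⟨hp⟩
  set X := pilotDataOfK T.D T.K with hX
  set pp : Nat.Primes := ⟨ratChar u, hp⟩ with hpp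
  -- the K-fibre point on the place of the member
  obtain ⟨x', hx'⟩ : ∃ x' : (thetaIndex X).Fibre (.inr pp), placeOf X (ratChar u) x' = placeOfM T.D u x₀ := by
    refine ⟨(fibreEquivPlacesOver X pp).symm
      ⟨placeOfM T.D u x₀, placeOfM_mem_placesOver T.D (ratChar u) u (natCast_ratChar_mem u) x₀⟩, ?_⟩
    show (fibreEquivPlacesOver X pp ((fibreEquivPlacesOver X pp).symm _)).1 = _
    rw [Equiv.apply_symm_apply]
  have heK : absRamificationIdx (pp : ℕ) (kOf X pp.1 x') = absRamificationIdx (ratChar u) (kOfM T.D (ratChar u) u (natCast_ratChar_mem u) x₀) := by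
    show absRamificationIdx (ratChar u) (kOf X (ratChar u) x') = _
    rw [absRamificationIdx_rescaledCompletion, absRamificationIdx_rescaledCompletion, hx']
  rw [← heK]
  exact hK x'

/-! ## §2. The pinned socket with a K-fibre type, every idele datum -/

/-- **THE HULL LICENCE FAILS AT THE OWN-IDELES M-LEVEL SETTING OF AN abc-TRIPLE DATUM WHEN R-H ROW 4's COLUMN FAILS AT A TAME TYPE PINNED ON THE K FIBRE.**
`a + b = c` an abc triple, `l` any level, `T` a genuine Θ-volume datum at `(ratPoint (a/c), l)`, `r` ANY idele datum of `T.D`; a finite place `u` of `ℚ` with `p_u = p`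
prime, `p ∣ abc`, `p ≠ 2, l`; the K-fibre type over `p` PINNED: `e(K_{x'}/ℚ_p) = e₀` for every K-fibre point `x'`, with `p ∤ e₀`, `e₀·v_p(abc) = l·P`; a label
`i + 1 ≤ (l−1)/2`; a turning point `a₀` of `e₀`; and `¬ HullCell e₀ P (i+1) (⌊e₀/(p−1)⌋+1) (p^{a₀} − a₀·e₀)`. THEN `¬ Thm311ToCor312.Licence (settingPrVolSharpM T.D hlog
(tOfIdeleData T.D r) (tqM … r) …)` for every analytic `logv`, every context datum, any `htq0/Sq/htq1`: the fibre `V̲_u` is non-empty (`fibre_nonempty`), its member has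
type `e₀` (§1), and this seat's pinned member socket `WRowM.not_licence_triple_of_not_hullCell` (p527646) applies BY NAME.
[cite: Mochizuki2012, IUTchI Ex. 3.2 (iv) p. 71; IUTchIII Cor. 3.12 Step (xi-f) p. 184; IUTchIV Prop. 1.1 p. 9, Prop. 1.2 (i)(ii) p. 10, Cor. 2.2 (ii) proof (P5) p. 46]
[cite: DupuyHilado2025, §3.4, §4.9, §4.12] [cite: SerreLocalFields1979, Ch. III §6 Prop. 13] [claim: Mochizuki2012, status: disputed] -/
theorem WRowM.not_licence_triple_of_not_hullCell_kFibre {a b c l : ℕ} (habc : IsABCTriple a b c)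
    (T : Cor22.ThetaVolumeDatumAt (ratPoint ((a : ℚ) / c)) l) (u : FinitePlace ℚ) (p : ℕ) (hu : ratChar u = p) (hp : p.Prime)
    (hp2 : p ≠ 2) (hpl : p ≠ l) (hpabc : p ∣ a * b * c) {e₀ P i a₀ : ℕ} (hpe : ¬ p ∣ e₀)
    (hK : letI := T.instFieldF; letI := T.instNumberFieldF; letI := T.instAlgebraF; letI := T.instFieldK
      letI := T.instNumberFieldK; letI := T.instAlgebraK; letI := T.instFieldFbar; letI := T.instAlgebraFbar
      letI := T.instAlgebraKFbar; letI := T.instIsElliptic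
      haveI : Fact p.Prime := ⟨hp⟩
      ∀ x' : (thetaIndex (pilotDataOfK T.D T.K)).Fibre (.inr ⟨p, hp⟩), absRamificationIdx p (kOf (pilotDataOfK T.D T.K) p x') = e₀)
    (hP : e₀ * (a * b * c).factorization p = l * P) (hi : i + 1 ≤ (l - 1) / 2)
    (hlo : ∀ t : ℕ, t < a₀ → (1 : ℤ) * (p : ℤ) ^ t * ((p : ℤ) - 1) < (e₀ : ℤ))
    (hhi : (e₀ : ℤ) ≤ 1 * (p : ℤ) ^ a₀ * ((p : ℤ) - 1))
    (hneg : ¬ HullCell (e₀ : ℤ) (P : ℤ) ((i : ℤ) + 1) ((e₀ / (p - 1) + 1 : ℕ) : ℤ) ((p : ℤ) ^ a₀ - (a₀ : ℤ) * (e₀ : ℤ))) :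
    letI := T.instFieldF; letI := T.instNumberFieldF; letI := T.instAlgebraF; letI := T.instFieldK
    letI := T.instNumberFieldK; letI := T.instAlgebraK; letI := T.instFieldFbar; letI := T.instAlgebraFbar
    letI := T.instAlgebraKFbar; letI := T.instIsElliptic
    ∀ {logvK : PadicLogsVal T.K} (hlog : LogvAnalyticVal logvK) (r : ThetaData.IdeleData T.D) (M : Type) [Field M] [NumberField M]
      (archPk : ∀ (j : (thetaIndexOfInitial T.D).Label) (vQ : (thetaIndexOfInitial T.D).VQ),
        Set ((logShellsOfInitialDH T.D logvK).Packet j vQ))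
      (archSub : ∀ (j : (thetaIndexOfInitial T.D).Label) (v : (thetaIndexOfInitial T.D).V),
        Set ((logShellsOfInitialDH T.D logvK).Packet j ((thetaIndexOfInitial T.D).over v)))
      (Ψ : ℤ → ∀ v : (thetaIndexOfInitial T.D).V, v ∈ (thetaIndexOfInitial T.D).Vbad →
        Set ((logShellsOfInitialDH T.D logvK).StarPacket v))
      (act : ℤ → ∀ v : (thetaIndexOfInitial T.D).V, v ∈ (thetaIndexOfInitial T.D).Vbad →
        (logShellsOfInitialDH T.D logvK).StarPacket v → Module.End ℚ ((logShellsOfInitialDH T.D logvK).StarPacket v))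
      (Mmod : ℤ → ∀ j : (thetaIndexOfInitial T.D).LabelStar, Set ((logShellsOfInitialDH T.D logvK).GlobalPacket j.1))
      (region : ℤ → ∀ j : (thetaIndexOfInitial T.D).LabelStar, FinDivisor M → ∀ vQ : (thetaIndexOfInitial T.D).VQ,
        Set ((logShellsOfInitialDH T.D logvK).Packet j.1 vQ))
      (n : ℤ) {HT : Type} {LogLink : HT → HT → Type} {IsFull : ∀ {s t : HT}, LogLink s t → Prop}
      (lat : LGPGaussianLogThetaLattice LogLink IsFull)
      {Frd : Type} {IsoF : Frd → Frd → Type} {Ob : Frd → Type} {realify : Frd → Frd} {Strip : Type}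
      {IsoS : Strip → Strip → Type}
      {Mv : ∀ v : (thetaIndexOfInitial T.D).V, v ∈ (thetaIndexOfInitial T.D).Vbad → Type} [∀ v h, Monoid (Mv v h)]
      (sig : GlobalLGPFrobenioidSignature (thetaIndexOfInitial T.D).lstar (thetaIndexOfInitial T.D).V
        (· ∈ (thetaIndexOfInitial T.D).Vbad) Frd IsoF Ob realify Strip IsoS Mv)
      (split : SplittingMonoids Mv) {ObΔ : Type}
      {N : ∀ v : (thetaIndexOfInitial T.D).V, v ∈ (thetaIndexOfInitial T.D).Vbad → Type} [∀ v h, Monoid (N v h)]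
      (qData : QPilotData ObΔ N)
      (htq0 : ∀ (u : FinitePlace ℚ) (x : (thetaIndexOfInitial T.D).Fibre (Val.non u)),
        tqM T.D (ratChar u) u (natCast_ratChar_mem u) r x ≠ 0)
      (Sq : Finset (FinitePlace ℚ))
      (htq1 : ∀ (u : FinitePlace ℚ) (x : (thetaIndexOfInitial T.D).Fibre (Val.non u)), u ∉ Sq →
        ‖tqM T.D (ratChar u) u (natCast_ratChar_mem u) r x‖ = 1),
      ¬ Thm311ToCor312.Licence
        (settingPrVolSharpM T.D hlog (tOfIdeleData T.D r) (fun u x => tqM T.D (ratChar u) u (natCast_ratChar_mem u) r x) M archPk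
          archSub Ψ act Mmod region n lat sig split qData htq0 Sq htq1) := by
  classical
  letI := T.instFieldF; letI := T.instNumberFieldF; letI := T.instAlgebraF; letI := T.instFieldK
  letI := T.instNumberFieldK; letI := T.instAlgebraK; letI := T.instFieldFbar; letI := T.instAlgebraFbar
  letI := T.instAlgebraKFbar; letI := T.instIsElliptic
  intro logvK hlog r M _ _ archPk archSub Ψ act Mmod region n HT LogLink IsFull lat Frd IsoF Ob realify Strip IsoS Mv _ sig split ObΔ N _
    qData htq0 Sq htq1
  obtain ⟨y, hy⟩ := (thetaIndexOfInitial T.D).fibre_nonempty (Val.non u)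
  have hloc := WRowM.absRamificationIdx_kOfM_of_kFibre T u p hu hp hK ⟨y, hy⟩
  exact WRowM.not_licence_triple_of_not_hullCell habc T u p hu hp2 hpl hpabc (e₀ := e₀) (P := P) (i := i) (a₀ := a₀) hpe
    ⟨y, hy⟩ hloc hP hi hlo hhi hneg hlog r M archPk archSub Ψ act Mmod region n lat sig split qData htq0 Sq htq1

/-! ## §3. The M books' instance shape -/

/-- **The same refutation in the M books' instance shape** (`Conditional.abc_of_SH_v11M_window` / `…_szpiroBadAll`: own ideles `ideleDataOf T.D T.isVolumeInputOf`,
analytic `logv`, pinned reading, every free binder): at such a datum `¬ PilotKummerCompatHull (LatticeSituation.ofShells …) (settingPrVolSharpM T.D …) (pinned qRegion) qK` —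
§2 composed with abc-iut-c312-5's `licence_of_pilotKummerCompatHull`, exactly as this seat's `GenuineM.not_pilotKummerCompatHull_triple_of_hullCells_tameSharp` (p528325).
[cite: Mochizuki2012, IUTchIII Cor. 3.12 Step (xi-f) p. 184; IUTchIV Prop. 1.2 (i)(ii) p. 10] [cite: DupuyHilado2025, §3.4, §4.9, §4.12] [claim: Mochizuki2012, status: disputed] -/
theorem GenuineM.not_pilotKummerCompatHull_triple_of_not_hullCell_kFibre {a b c l : ℕ} (habc : IsABCTriple a b c)
    (T : Cor22.ThetaVolumeDatumAt (ratPoint ((a : ℚ) / c)) l) (u : FinitePlace ℚ) (p : ℕ) (hu : ratChar u = p) (hp : p.Prime)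
    (hp2 : p ≠ 2) (hpl : p ≠ l) (hpabc : p ∣ a * b * c) {e₀ P i a₀ : ℕ} (hpe : ¬ p ∣ e₀)
    (hK : letI := T.instFieldF; letI := T.instNumberFieldF; letI := T.instAlgebraF; letI := T.instFieldK
      letI := T.instNumberFieldK; letI := T.instAlgebraK; letI := T.instFieldFbar; letI := T.instAlgebraFbar
      letI := T.instAlgebraKFbar; letI := T.instIsElliptic
      haveI : Fact p.Prime := ⟨hp⟩
      ∀ x' : (thetaIndex (pilotDataOfK T.D T.K)).Fibre (.inr ⟨p, hp⟩), absRamificationIdx p (kOf (pilotDataOfK T.D T.K) p x') = e₀)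
    (hP : e₀ * (a * b * c).factorization p = l * P) (hi : i + 1 ≤ (l - 1) / 2)
    (hlo : ∀ t : ℕ, t < a₀ → (1 : ℤ) * (p : ℤ) ^ t * ((p : ℤ) - 1) < (e₀ : ℤ))
    (hhi : (e₀ : ℤ) ≤ 1 * (p : ℤ) ^ a₀ * ((p : ℤ) - 1))
    (hneg : ¬ HullCell (e₀ : ℤ) (P : ℤ) ((i : ℤ) + 1) ((e₀ / (p - 1) + 1 : ℕ) : ℤ) ((p : ℤ) ^ a₀ - (a₀ : ℤ) * (e₀ : ℤ))) :
    letI := T.instFieldF; letI := T.instNumberFieldF; letI := T.instAlgebraF; letI := T.instFieldK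
    letI := T.instNumberFieldK; letI := T.instAlgebraK; letI := T.instFieldFbar; letI := T.instAlgebraFbar
    letI := T.instAlgebraKFbar; letI := T.instIsElliptic
    ∀ (M : Type) [Field M] [NumberField M]
      (archPk : ∀ (j : (thetaIndexOfInitial T.D).Label) (vQ : (thetaIndexOfInitial T.D).VQ),
        Set ((logShellsOfInitialDH T.D (analyticLogvVal T.K)).Packet j vQ))
      (archSub : ∀ (j : (thetaIndexOfInitial T.D).Label) (v : (thetaIndexOfInitial T.D).V),
        Set ((logShellsOfInitialDH T.D (analyticLogvVal T.K)).Packet j ((thetaIndexOfInitial T.D).over v)))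
      (Ψ : ℤ → ∀ v : (thetaIndexOfInitial T.D).V, v ∈ (thetaIndexOfInitial T.D).Vbad →
        Set ((logShellsOfInitialDH T.D (analyticLogvVal T.K)).StarPacket v))
      (act : ℤ → ∀ v : (thetaIndexOfInitial T.D).V, v ∈ (thetaIndexOfInitial T.D).Vbad →
        (logShellsOfInitialDH T.D (analyticLogvVal T.K)).StarPacket v →
          Module.End ℚ ((logShellsOfInitialDH T.D (analyticLogvVal T.K)).StarPacket v))
      (Mmod : ℤ → ∀ j : (thetaIndexOfInitial T.D).LabelStar, Set ((logShellsOfInitialDH T.D (analyticLogvVal T.K)).GlobalPacket j.1))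
      (region : ℤ → ∀ j : (thetaIndexOfInitial T.D).LabelStar, FinDivisor M → ∀ vQ : (thetaIndexOfInitial T.D).VQ,
        Set ((logShellsOfInitialDH T.D (analyticLogvVal T.K)).Packet j.1 vQ))
      (frobAdm : ℤ → ℤ → ∀ (j : (thetaIndexOfInitial T.D).Label) (vQ : (thetaIndexOfInitial T.D).VQ),
        Set ((logShellsOfInitialDH T.D (analyticLogvVal T.K)).Packet j vQ) → Prop)
      (frobLogvol : ℤ → ℤ → ∀ (j : (thetaIndexOfInitial T.D).Label) (vQ : (thetaIndexOfInitial T.D).VQ),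
        Set ((logShellsOfInitialDH T.D (analyticLogvVal T.K)).Packet j vQ) → ℝ)
      (frobΨ : ℤ → ℤ → ∀ v : (thetaIndexOfInitial T.D).V, v ∈ (thetaIndexOfInitial T.D).Vbad →
        Set ((logShellsOfInitialDH T.D (analyticLogvVal T.K)).StarPacket v))
      (frobMmod : ℤ → ℤ → ∀ j : (thetaIndexOfInitial T.D).LabelStar, Set ((logShellsOfInitialDH T.D (analyticLogvVal T.K)).GlobalPacket j.1))
      (unitImage : ℤ → ℤ → ℕ → ∀ (j : (thetaIndexOfInitial T.D).Label) (vQ : (thetaIndexOfInitial T.D).VQ),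
        Set ((logShellsOfInitialDH T.D (analyticLogvVal T.K)).Packet j vQ))
      (ballImage : ℤ → ℤ → ∀ (j : (thetaIndexOfInitial T.D).Label) (vQ : (thetaIndexOfInitial T.D).VQ),
        Set ((logShellsOfInitialDH T.D (analyticLogvVal T.K)).Packet j vQ))
      (thetaDiv : ℤ → ℤ → LgpDivisor M (thetaIndexOfInitial T.D).lstar)
      (n : ℤ) {HT : Type} {LogLink : HT → HT → Type} {IsFull : ∀ {s t : HT}, LogLink s t → Prop}
      (lat : LGPGaussianLogThetaLattice LogLink IsFull)
      {Frd : Type} {IsoF : Frd → Frd → Type} {Ob : Frd → Type} {realify : Frd → Frd} {Strip : Type}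
      {IsoS : Strip → Strip → Type} {Mv : ∀ v : (thetaIndexOfInitial T.D).V, v ∈ (thetaIndexOfInitial T.D).Vbad → Type}
      [∀ v h, Monoid (Mv v h)]
      (sig : GlobalLGPFrobenioidSignature (thetaIndexOfInitial T.D).lstar (thetaIndexOfInitial T.D).V
        (· ∈ (thetaIndexOfInitial T.D).Vbad) Frd IsoF Ob realify Strip IsoS Mv)
      (split : SplittingMonoids Mv) {ObΔ : Type} {N : ∀ v : (thetaIndexOfInitial T.D).V, v ∈ (thetaIndexOfInitial T.D).Vbad → Type}
      [∀ v h, Monoid (N v h)] (qData : QPilotData ObΔ N)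
      (qK : ∀ v : (thetaIndexOfInitial T.D).V, v ∈ (thetaIndexOfInitial T.D).Vbad →
        Set ((logShellsOfInitialDH T.D (analyticLogvVal T.K)).StarPacket v)),
      ¬ Cor312Vol.PilotKummerCompatHull
        (LatticeSituation.ofShells (logShellsOfInitialDH T.D (analyticLogvVal T.K)) M archPk archSub
          (summandPiecesPrM T.D (logvAnalyticVal_analyticLogvVal (K := T.K))).Adm (summandPiecesPrM T.D (logvAnalyticVal_analyticLogvVal (K := T.K))).logvol Ψ act Mmod region frobAdm frobLogvol
          frobΨ frobMmod unitImage ballImage thetaDiv)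
        (settingPrVolSharpM T.D (logvAnalyticVal_analyticLogvVal (K := T.K)) (tOfIdeleData T.D (ideleDataOf T.D T.isVolumeInputOf))
          (fun u x => tqM T.D (ratChar u) u (natCast_ratChar_mem u) (ideleDataOf T.D T.isVolumeInputOf) x) M archPk archSub Ψ act Mmod region n lat sig split qData
          (fun u x => tqM_ne_zero T.D (ratChar u) u (natCast_ratChar_mem u) (ideleDataOf T.D T.isVolumeInputOf) x)
          (GenuineM.finite_ratPlaces_under_S T.D).toFinset
          (fun u x hu => norm_tqM_eq_one_of_not_mem T.D (ratChar u) u (natCast_ratChar_mem u) (ideleDataOf T.D T.isVolumeInputOf) x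
            fun hx => hu ((Set.Finite.mem_toFinset _).mpr ⟨x, hx⟩)))
        (fun _ => Cor312.Setting.qRegion
          (settingPrVolSharpM T.D (logvAnalyticVal_analyticLogvVal (K := T.K)) (tOfIdeleData T.D (ideleDataOf T.D T.isVolumeInputOf))
          (fun u x => tqM T.D (ratChar u) u (natCast_ratChar_mem u) (ideleDataOf T.D T.isVolumeInputOf) x) M archPk archSub Ψ act Mmod region n lat sig split qData
          (fun u x => tqM_ne_zero T.D (ratChar u) u (natCast_ratChar_mem u) (ideleDataOf T.D T.isVolumeInputOf) x)
          (GenuineM.finite_ratPlaces_under_S T.D).toFinset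
          (fun u x hu => norm_tqM_eq_one_of_not_mem T.D (ratChar u) u (natCast_ratChar_mem u) (ideleDataOf T.D T.isVolumeInputOf) x
            fun hx => hu ((Set.Finite.mem_toFinset _).mpr ⟨x, hx⟩)))) qK := by
  classical
  letI := T.instFieldF; letI := T.instNumberFieldF; letI := T.instAlgebraF; letI := T.instFieldK
  letI := T.instNumberFieldK; letI := T.instAlgebraK; letI := T.instFieldFbar; letI := T.instAlgebraFbar
  letI := T.instAlgebraKFbar; letI := T.instIsElliptic
  intro M _ _ archPk archSub Ψ act Mmod region frobAdm frobLogvol frobΨ frobMmod unitImage ballImage thetaDiv n HT LogLink IsFull lat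
    Frd IsoF Ob realify Strip IsoS Mv _ sig split ObΔ N _ qData qK hSH
  exact WRowM.not_licence_triple_of_not_hullCell_kFibre habc T u p hu hp hp2 hpl hpabc hpe hK hP hi hlo hhi hneg
    (logvAnalyticVal_analyticLogvVal (K := T.K)) (ideleDataOf T.D T.isVolumeInputOf) M archPk archSub Ψ act Mmod region n lat sig split qData
    (fun u x => tqM_ne_zero T.D (ratChar u) u (natCast_ratChar_mem u) (ideleDataOf T.D T.isVolumeInputOf) x)
    (GenuineM.finite_ratPlaces_under_S T.D).toFinset
    (fun u x hu => norm_tqM_eq_one_of_not_mem T.D (ratChar u) u (natCast_ratChar_mem u) (ideleDataOf T.D T.isVolumeInputOf) x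
      fun hx => hu ((Set.Finite.mem_toFinset _).mpr ⟨x, hx⟩))
    (licence_of_pilotKummerCompatHull
      (LatticeSituation.ofShells (logShellsOfInitialDH T.D (analyticLogvVal T.K)) M archPk archSub
        (summandPiecesPrM T.D (logvAnalyticVal_analyticLogvVal (K := T.K))).Adm
        (summandPiecesPrM T.D (logvAnalyticVal_analyticLogvVal (K := T.K))).logvol Ψ act Mmod region frobAdm frobLogvol
        frobΨ frobMmod unitImage ballImage thetaDiv)
      _ _ qK (fun _ _ => rfl) hSH)

end Summit.ABC.IUTFork.Conditional

end
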